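import Summits.CriticalPhenomena.CardyFormulaZ2.Theorems.CardyRotToConfR2SymmetryUpgradeFatSurgeryLocalGeom
import Summits.CriticalPhenomena.CardyFormulaZ2.Theorems.CardyRotToConfR2SymmetryUpgradeFatSurgeryLocalStop
import Summits.CriticalPhenomena.CardyFormulaZ2.Theorems.CardyRotToConfR2SymmetryUpgradeFatSurgeryChordal
import HarnessLib

/-!
# The fat-germ one-shot surgery of an admissible family is local (restriction form)
# (line `germ-label-transport`, crux `stmt-CriticalPhenomena-0698`, stub `stub_fatSurgeryLocal`)

`ChordalFamily.IsLocal` (LSW 2001, Cor. 2.4, restriction form) for `J = Negative.fatSurgery S`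
(`SurgFatFamily`), `S` admissible (only `S.IsLocal` and `S.IsChordal` are used). Fix Dobrushin
domains `D' ⊆ D` with the same marked points `a, b`, the stopping set `F = closure (D ∖ D')`
(closed, disjoint from the open set `D'`) and a measurable `T`; claim
`J D' (stopAt F ⁻¹' T) = J D (stopAt F ⁻¹' T)`.

* `a ∈ F`: both laws are carried by classes starting at `a` (`FatSurgeryChordal.isChordal_fatSurgery`), all stopped
  at once at the constant class (`CurveClass.stopAt_eq_of_source_mem`): deterministic on both sides
  (`measure_preimage_stopAt_eq_of_ae`).
* `a ∉ F`: a ball about `a` misses `F`, so `D`, `D'` agree in it; the firing predicate and the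
  firing direction are germ invariants (`fires_congr`, `fireDir_congr`), so either neither domain
  fires (`J = S` on both: locality of `S`), or both fire along the same ray, and the smaller
  domain exits no later: `τ' ≤ τ` (infimum over a larger exit set).
  - If the landing point `q'` of `D'` lies in `F` (always so if `τ' < τ`: then `q' ∈ D ∖ D'`):
    ray points before `τ'` are in `D'`, off `F`; so the chord of `D'` meets `F` only at its
    endpoint and `J D'`-a.s. the stopped class is the chord of `D'`
    (`ae_stopAt_fatSurgery_eq_chord`), while the chord of `D` first meets `F` at parameter
    `τ'/τ`, where it is stopped to the very same curve (`ae_stopAt_fatSurgery_eq`,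
    `stopAt_fireChord_eq`): deterministic on both sides.
  - Else `τ' = τ`, the chords coincide and miss `F`. If `q = b` both laws are the same Dirac
    mass. If `q ≠ b`, with the crosscut domains `E' ⊆ E` of the common chord
    (`bComponent_subset_bComponent`) and `F* = closure (E ∖ E') ⊆ F` (`bComponent_diff_subset`):
    on `closure E` the sets `F` and `F*` agree (`closure_diff_inter_closure_subset`: the
    difference lies on the chord, which misses `F`), hence `stopAt F = stopAt F*` on classes with
    trace in `closure E` (`stopAt_congr_set`), and `stopAt F ∘ firePrefix = firePrefix ∘ stopAt F`
    on classes from `q` (`stopAt_firePrefix_of_forall_notMem`). Unfolding the push-forwards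
    (`map_apply_preimage_stopAt`) and using chordality of `S E'`, `S E` (a.s. source `q`, trace in
    the closure), both sides become `S E' / S E (stopAt F* ⁻¹' (firePrefix ⁻¹' T))`, equal by the
    locality of `S` on `E' ⊆ E` (marks `q`, `b`).

References: G. Lawler, O. Schramm, W. Werner, *Values of Brownian intersection exponents I*, Acta
Math. 187 (2001), Cor. 2.4; W. Werner, *Lectures on two-dimensional critical percolation* (2007),
§3.2.
-/

noncomputable section

open Set Filter Topology Metric MeasureTheory
open scoped unitInterval

namespace Summit.CriticalPhenomena.CardyFormulaZ2.Theorems.CardyRotToConfR2SymmetryUpgrade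

open Literature.Probability.RandomPlanarGeometry Literature.Probability.RandomPlanarGeometry.ChordalFamily
open Summit.CriticalPhenomena.CardyFormulaZ2.Theorems.CardyRotToConfR2SymmetryUpgrade.Negative

namespace FatSurgeryLocal

/-! ### Two domains agreeing near `a`: same ray, ordered exits -/

section Germ

variable {D D' : DobrushinDomain}

/-- Domains `D' ⊆ D` agree in a ball about `a` as soon as the ball misses `closure (D ∖ D')`.
[folklore] -/
theorem inter_ball_eq (hsub : D'.carrier ⊆ D.carrier) {ρ : ℝ}
    (hball : ball (D.pt 0) ρ ⊆ (closure (D.carrier \ D'.carrier))ᶜ) :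
    D.carrier ∩ ball (D.pt 0) ρ = D'.carrier ∩ ball (D.pt 0) ρ := by
  refine Subset.antisymm (fun x hx => ⟨?_, hx.2⟩) (fun x hx => ⟨hsub hx.1, hx.2⟩)
  by_contra hxD'
  exact hball hx.2 (subset_closure ⟨hx.1, hxD'⟩)

variable (h0 : D'.pt 0 = D.pt 0) (htip : fireTip D' = fireTip D)
include h0 htip

/-- With the same base point and ray, the exit parameter of `D'` along the ray of `D`. [folklore] -/
theorem fireExit_eq' : fireExit D' = exitParam D'.carrier (D.pt 0) (fireTip D) := by
  rw [fireExit, htip, h0]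

/-- With the same base point and ray, the landing point of `D'` on the ray of `D`. [folklore] -/
theorem firePt_eq' : firePt D' = rayPt (D.pt 0) (fireTip D) (fireExit D') := by
  rw [firePt, htip, h0]

/-- With the same base point and ray, the chord of `D'` along the ray of `D`. [folklore] -/
theorem fireChord_apply' (s : I) :
    fireChord D' s = rayPt (D.pt 0) (fireTip D) ((s : ℝ) * fireExit D') := by
  rw [fireChord_apply, htip, h0]

/-- **The smaller domain exits no later**: `τ' ≤ τ`. [folklore] -/
theorem fireExit_le (hD : Fires D.carrier (D.pt 0)) (hsub : D'.carrier ⊆ D.carrier) :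
    fireExit D' ≤ fireExit D := by
  rw [fireExit_eq' h0 htip, fireExit]
  show sInf {t : ℝ | 0 < t ∧ rayPt (D.pt 0) (fireTip D) t ∉ D'.carrier} ≤
    sInf {t : ℝ | 0 < t ∧ rayPt (D.pt 0) (fireTip D) t ∉ D.carrier}
  exact csInf_le_csInf ⟨0, fun t ht => ht.1.le⟩ (exitSet_nonempty' D.isBounded (fireTip_ne hD))
    fun t ht => ⟨ht.1, fun htD' => ht.2 (hsub htD')⟩

/-- **The big chord stopped where the small chord ends is the small chord**: if the chord of `D`
first hits `F` at the parameter `τ'/τ`, its initial segment up to `F` is the chord of `D'`, as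
parametrised curves. [folklore] -/
theorem stopAt_fireChord_eq (hD : Fires D.carrier (D.pt 0)) {F : Set ℂ} {sg : I}
    (hsg : (fireChord D).hitParam F = sg) (hsgv : (sg : ℝ) = fireExit D' / fireExit D) :
    (fireChord D).stopAt F = fireChord D' := by
  have hτ := fireExit_pos hD
  refine Curve.ext (ContinuousMap.ext fun s => ?_)
  show (fireChord D).stopAt F s = fireChord D' s
  have hmemI : (sg : ℝ) * s ∈ Icc (0 : ℝ) 1 :=
    ⟨mul_nonneg sg.2.1 s.2.1, mul_le_one₀ sg.2.2 s.2.1 s.2.2⟩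
  rw [Curve.stopAt_apply, hsg, projIcc_of_mem _ hmemI, fireChord_apply, fireChord_apply' h0 htip]
  congr 1
  show (sg : ℝ) * s * fireExit D = s * fireExit D'
  rw [hsgv]
  field_simp

end Germ

/-! ### The stub -/

/-- **The fat-germ one-shot surgery of an admissible chordal family is local** (restriction form,
LSW Cor. 2.4). [folklore] -/
theorem isLocal_fatSurgery {S : ChordalFamily} (hS : IsLocalMarkovChordalFamily S) :
    (fatSurgery S).IsLocal := by
  intro D D' hsub h0 h1 T hT
  set F := closure (D.carrier \ D'.carrier) with hFdef
  have hF : IsClosed F := isClosed_closure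
  have hFD' : ∀ x ∈ D'.carrier, x ∉ F := fun x hx hxF =>
    (closure_minimal (fun y hy => hy.2) D'.isOpen.isClosed_compl : F ⊆ D'.carrierᶜ) hxF hx
  haveI := isProbabilityMeasure_fatSurgery hS.isChordal D
  haveI := isProbabilityMeasure_fatSurgery hS.isChordal D'
  by_cases ha : D.pt 0 ∈ F
  · -- both stopped at once at the constant class at `a`
    refine measure_preimage_stopAt_eq_of_ae (c := CurveClass.mk (Curve.const (D.pt 0))) ?_ ?_ T
    · filter_upwards [(FatSurgeryChordal.isChordal_fatSurgery hS.isChordal D').2] with γ hγ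
      rw [CurveClass.stopAt_eq_of_source_mem (by rw [hγ.1, h0]; exact ha), hγ.1, h0]
    · filter_upwards [(FatSurgeryChordal.isChordal_fatSurgery hS.isChordal D).2] with γ hγ
      rw [CurveClass.stopAt_eq_of_source_mem (by rw [hγ.1]; exact ha), hγ.1]
  -- `a ∉ F`: the two domains agree near `a`
  obtain ⟨ρ, hρ, hball⟩ := Metric.isOpen_iff.1 hF.isOpen_compl (D.pt 0) ha
  have hagree : D.carrier ∩ ball (D.pt 0) ρ = D'.carrier ∩ ball (D.pt 0) ρ := inter_ball_eq hsub hball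
  by_cases hfire : Fires D.carrier (D.pt 0)
  swap
  · -- neither fires: `J = S` on both
    have hfire' : ¬ Fires D'.carrier (D'.pt 0) := fun h' =>
      hfire ((fires_congr hρ hagree).2 (by rw [← h0]; exact h'))
    rw [fatSurgery_of_not_fires hfire, fatSurgery_of_not_fires hfire']
    exact hS.isLocal D D' hsub h0 h1 T hT
  -- both fire, along the same ray
  have hfire' : Fires D'.carrier (D'.pt 0) := by rw [h0]; exact (fires_congr hρ hagree).1 hfire
  have htip : fireTip D' = fireTip D := by rw [fireTip, fireTip, h0, fireDir_congr hρ hagree]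
  have hτ := fireExit_pos hfire
  have hτ' := fireExit_pos hfire'
  have hle : fireExit D' ≤ fireExit D := fireExit_le h0 htip hfire hsub
  -- ray points strictly before `τ'` are in `D'`, hence off `F`
  have hray : ∀ t : ℝ, 0 < t → t < fireExit D' → rayPt (D.pt 0) (fireTip D) t ∉ F := by
    intro t ht0 ht
    rw [fireExit_eq' h0 htip] at ht
    exact hFD' _ (rayPt_mem_of_lt ht0 ht)
  -- chord points of `D'` before the landing point are off `F`
  have hlt' : ∀ t : I, (t : ℝ) < 1 → fireChord D' t ∉ F := by
    intro t ht1
    rw [fireChord_apply' h0 htip]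
    rcases eq_or_lt_of_le t.2.1 with ht0 | ht0
    · rw [← ht0, zero_mul, rayPt_zero]; exact ha
    · exact hray _ (mul_pos ht0 hτ') (by nlinarith)
  by_cases hqF : firePt D' ∈ F
  · -- deterministic: both stopped classes are a.s. the chord of `D'`
    set sg : I := ⟨fireExit D' / fireExit D, div_nonneg hτ'.le hτ.le, (div_le_one hτ).2 hle⟩ with hsgdef
    have hsgv : (sg : ℝ) = fireExit D' / fireExit D := rfl
    have hsg : (fireChord D).hitParam F = sg := by
      refine hitParam_eq_of_forall_lt (fun t ht => ?_) ?_
      · rw [fireChord_apply]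
        rcases eq_or_lt_of_le t.2.1 with ht0 | ht0
        · rw [← ht0, zero_mul, rayPt_zero]; exact ha
        · refine hray _ (mul_pos ht0 hτ) ?_
          rw [hsgv, lt_div_iff₀ hτ] at ht
          exact ht
      · rw [fireChord_apply, hsgv, div_mul_cancel₀ _ hτ.ne', ← firePt_eq' h0 htip]
        exact hqF
    refine measure_preimage_stopAt_eq_of_ae (c := CurveClass.mk (fireChord D')) ?_ ?_ T
    · exact ae_stopAt_fatSurgery_eq_chord hS.isChordal hfire' hF hlt' hqF
    · have key := ae_stopAt_fatSurgery_eq hS.isChordal hfire hF hsg (by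
        rw [fireChord_apply, hsgv, div_mul_cancel₀ _ hτ.ne', ← firePt_eq' h0 htip]; exact hqF)
      rwa [stopAt_fireChord_eq h0 htip hfire hsg hsgv] at key
  -- the landing point of `D'` is off `F`: then `τ' = τ` and the chords coincide
  have heq : fireExit D' = fireExit D := by
    refine hle.antisymm (not_lt.1 fun hlt => hqF ?_)
    refine subset_closure ⟨?_, ?_⟩
    · rw [firePt_eq' h0 htip]; exact rayPt_mem_carrier hτ' hlt
    · exact firePt_notMem_carrier hfire'
  have hchord : fireChord D' = fireChord D := by rw [fireChord, fireChord, htip, h0, heq]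
  have hpt : firePt D' = firePt D := by rw [firePt_eq' h0 htip, firePt, heq]
  by_cases hqb : firePt D = D.pt 1
  · have hqb' : firePt D' = D'.pt 1 := by rw [hpt, hqb, h1]
    rw [fatSurgery_of_eq hfire hqb, fatSurgery_of_eq hfire' hqb', hchord]
  have hqb' : firePt D' ≠ D'.pt 1 := by rwa [hpt, h1]
  -- the crosscut domains `E' ⊆ E` of the common chord
  have hL := isCrosscut_fireChord hfire
  have hL' := isCrosscut_fireChord hfire'
  have hLL' : (fireChord D').range = (fireChord D).range := by rw [hchord]
  have hEc : (fireDom hfire hqb).carrier = bComponent hL hqb := rfl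
  have hEc' : (fireDom hfire' hqb').carrier = bComponent hL' hqb' := rfl
  have hEE' : (fireDom hfire' hqb').carrier ⊆ (fireDom hfire hqb).carrier :=
    bComponent_subset_bComponent hL hqb hL' hqb' hsub h1 hLL'
  -- the whole chord misses `F`
  have hchordF : ∀ s, fireChord D s ∉ F := by
    intro s
    rcases eq_or_lt_of_le s.2.2 with hs1 | hs1
    · have hs : s = 1 := Subtype.ext hs1
      rw [hs, ← Curve.target_def, target_fireChord, ← hpt]
      exact hqF
    · rw [← hchord]; exact hlt' s hs1
  -- points of the chord inside `D` are open chord points, inside `D'`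
  have hLD : (fireChord D).range ∩ D.carrier ⊆ D'.carrier := by
    rintro _ ⟨⟨s, rfl⟩, hsD⟩
    have hs : ¬ (s = 0 ∨ s = 1) := fun hs =>
      ((D.isOpen.frontier_eq ▸ (fireChord_mem_frontier_iff hfire).2 hs).2 hsD)
    rw [not_or] at hs
    have hs0 : 0 < (s : ℝ) := lt_of_le_of_ne s.2.1 fun h0' => hs.1 (Subtype.ext h0'.symm)
    have hs1 : (s : ℝ) < 1 := lt_of_le_of_ne s.2.2 fun h1' => hs.2 (Subtype.ext h1')
    rw [← hchord]
    exact fireChord_mem_carrier hfire' hs0 hs1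
  -- on `closure E`, the stopping sets `F` and `F* = closure (E ∖ E')` agree
  have hFiff : ∀ x ∈ closure (fireDom hfire hqb).carrier,
      x ∈ F ↔ x ∈ closure ((fireDom hfire hqb).carrier \ (fireDom hfire' hqb').carrier) := by
    intro x hx
    refine ⟨fun hxF => ?_, fun hx' => closure_mono (bComponent_diff_subset hL hqb hL' hqb' hsub h1 hLL') hx'⟩
    rcases closure_diff_inter_closure_subset hL hqb hL' hqb' hLD ⟨hxF, hx⟩ with h | ⟨s, rfl⟩
    · exact h
    · exact absurd hxF (hchordF s)
  -- unfold the two push-forwards along the common prefixing map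
  have hπ : firePrefix D' = firePrefix D := by
    funext ξ
    rw [firePrefix, firePrefix, hchord]
  rw [fatSurgery_of_ne hfire hqb, fatSurgery_of_ne hfire' hqb', hπ,
    map_apply_preimage_stopAt (measurable_firePrefix D) hF hT,
    map_apply_preimage_stopAt (measurable_firePrefix D) hF hT]
  -- a.s. under `S G` (`G = E, E'`): stopping commutes with prefixing and only sees `F*`
  have key : ∀ G : DobrushinDomain, G.pt 0 = firePt D →
      closure G.carrier ⊆ closure (fireDom hfire hqb).carrier →
      S G (firePrefix D ⁻¹' (CurveClass.stopAt F ⁻¹' T)) =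
        S G (CurveClass.stopAt (closure ((fireDom hfire hqb).carrier \ (fireDom hfire' hqb').carrier))
          ⁻¹' (firePrefix D ⁻¹' T)) := by
    intro G hG0 hGcl
    refine measure_congr (Filter.eventuallyEq_set.2 ?_)
    filter_upwards [(hS.isChordal G).2] with ξ hξ
    obtain ⟨hsrc, -, hrange⟩ := hξ
    rw [hG0] at hsrc
    simp only [mem_preimage]
    rw [stopAt_firePrefix_of_forall_notMem hF hchordF hsrc, stopAt_congr_set hFiff (hrange.trans hGcl)]
  rw [key _ (by rw [pt_zero_fireDom, hpt]) (closure_mono hEE'), key _ (pt_zero_fireDom hfire hqb) Subset.rfl]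
  exact hS.isLocal (fireDom hfire hqb) (fireDom hfire' hqb') hEE'
    (by rw [pt_zero_fireDom, pt_zero_fireDom, hpt]) (by rw [pt_one_fireDom, pt_one_fireDom, h1]) _
    (hT.preimage (measurable_firePrefix D))

end FatSurgeryLocal

open FatSurgeryLocal in
/-- **S7f.3 (`stub_fatSurgeryLocal`).** The fat surgery of an admissible family is local
(restriction form). [folklore] -/
theorem stub_fatSurgeryLocal : ∀ S : ChordalFamily, IsLocalMarkovChordalFamily S → (Summit.CriticalPhenomena.CardyFormulaZ2.Theorems.CardyRotToConfR2SymmetryUpgrade.Negative.fatSurgery S).IsLocal :=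
  fun _ hS => isLocal_fatSurgery hS

end Summit.CriticalPhenomena.CardyFormulaZ2.Theorems.CardyRotToConfR2SymmetryUpgrade

end
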